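import Summits.NavierStokesRegularity.FluidComputer.GateBudgetArming
import HarnessLib

/-!
# What no tuning can beat, part 3 of 3: the CLOCK BUDGET, the ZENO LAW, and the rotor / drain /
# amplifier / amplitude NECESSITY inequalities (Tao's family: `ε²·M·K·θ³ ≤ 12T`)

Cell `pub-fluidc`, blueprint seat bp1 (gen 21); part 3 of ONE text (`GateBudget.lean`,
`GateBudgetArming.lean`, this file); namespace `Summit.NavierStokesRegularity.FluidComputer.GateBudget`.
HONEST FRAMING (verbatim): low prior, high value-of-information experiment on Tao's machine paradigm; NOT a
claim that NS blows up. Five-mode quadratic ODEs on `ℝ⁵` (`fiveGateCircuit ε σ μ R K`: CLOCK pump `ε : a → b`,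
SEED pump `σ : a → c`, TRIGGER amplifier `μ : b ⇒ c`, rotor `R : c ∘ (a,d)`, DRAIN pump `K : d → ã`; Tao's
retuned family `delayCircuitWith K M ε` is the slice `σ = ε²e^{-M}, μ = ε⁻¹M, R = ε⁻²`, and (5.5) is `M = K¹⁰`)
started EXACTLY at (5.6) `delayInit`; nothing is proved about the Navier–Stokes equations.

## The mechanism (two more conservation laws, read at the level of derivatives — no integrals appear)

CLOCK BUDGET. `∂ₜb = εa² - μc²`: the amplifier takes from the clock exactly `μc²`, and the clock only ever
receives `εa² ≤ ε`; since `|b| ≤ (ε+σ)t` (part 1), `μ∫₀ᵀc² = ε∫₀ᵀa² - b(T) ≤ (2ε+σ)T`. THE TRIGGER HAS TINY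
`L²`-MASS: however violently it is amplified, `c` is large only briefly (the pulse).
ZENO LAW. `∂ₜ(d²+ã²) = 2Rcad ≤ Rλc² + (R/λ)d²` for any `λ > 0` (`|a| ≤ 1`), and `d² = ∂ₜã/K`: so
`Ψ = (d²+ã²) + (Rλ/μ)b - (R/(λK))ã - (Rλε/μ)t` is non-increasing (`zeno_antitone`), i.e.
`ã(T)² ≤ d²+ã² ≤ (Rλ/μ)(2ε+σ)T + Rã(T)/(λK)` (`zeno_law`); optimising `λ`: an output `ã(T) ≥ θ > 0` forces

  `K·θ³·μ ≤ 4R²·(2ε+σ)·T`   (`design_inequality`).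

A drain faster than the rotor can feed it keeps `d` pinned near `0` and throttles the very flux `2Rcad` it is
meant to deliver (a watched-pot / Zeno effect); a sharper amplifier makes the pulse shorter; a weaker rotor or
clock feeds less. READ AS NECESSARY CONDITIONS for firing (`ã(T) ≥ θ`) — each for EVERY value of the other
couplings: ROTOR `R ≥ √(μKθ³/(4(2ε+σ)T))` (part 1 had `2θ/((ε+σ)T²)`); DRAIN `K ≤ 4R²(2ε+σ)T/(μθ³)` (the
upper edge; the lower edge `K ≥ log(1/(1-θ))/(2T)` is the tree's `DelayWith.output_deficit_ge`); AMPLIFIER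
`μ ≤ 4R²(2ε+σ)T/(Kθ³)` (upper edge; the lower edge is part 2's arming law) — `amplifier_window`.

## Tao's family (`σ = ε²e^{-M} ≤ ε²`, `μ = ε⁻¹M`, `R = ε⁻²`; `0 < ε ≤ 1`)

`taoFamily_design_inequality`: `ã(T) ≥ θ > 0 ⇒ ε²·M·K·θ³ ≤ 12T`. With `θ = 1/2`, `T = 2`
(`taoFamily_fires_only_if`): `ε²MK ≤ 192`, i.e. `ε ≤ 14/√(MK)` — THE AMPLITUDE MUST BE POLYNOMIALLY SMALL IN
`M·K`, the necessity counterpart of the cell's sufficiency thresholds: for Tao's member `M = K¹⁰`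
(`taoMember_fires_only_if`) `ε ≤ 14·K^{-11/2}` is necessary while `ε ≤ e^{-700K⁹log K}/K¹⁸⁰⁰` suffices
(bp1 gen 20's `AmplitudeKnob.taoMember_polyPulse`; the tree's `DelayedAbruptTransition_holds` has
`e^{-10K¹⁰}/K¹⁰⁰`); in the linear band `700·M·log K ≤ K` the necessary `ε ≤ 14/√(MK)` (`≥ 370√(log K)/K`
there) faces the sufficient `ε ≤ K⁻¹⁸⁰¹` (`AmplitudeKnob.transition_linearAmplifier`). THE ROTOR KNOB
(`rotorKnob_necessary`, Tao's other couplings, free `R`): `M·K·θ³ ≤ 12T·(Rε)²` — the rotor must beat the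
clock scale `1/ε` by the factor `√(MKθ³/(12T))`; Tao's `R = ε⁻²` passes iff `ε²MKθ³ ≤ 12T`. THE DRAIN WINDOW
(`taoFamily_drain_window`): `log(1/(1-θ))/(2T) ≤ K ≤ 12T/(ε²Mθ³)`.
HONEST LIMITS. These are one-sided budget laws (Cauchy–Schwarz / AM–GM); for `M ≫ K` the pulse-DURATION
heuristic of `AmplitudeKnob.lean` (rotor fast only for `Θ(log(1/(εK))/M)`, drain needs `Θ(log K/K)`) predicts
the sharper necessity `ε ≤ K^{-Θ(M/K)}`, which is NOT a theorem here. [cite: Tao2016AveragedNS, §5.5 Theorem 5.3,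
(b-eq), (ta-eq), (dora), (energy-con)]. No named facts; 0 sorry.
-/

noncomputable section

namespace Summit.NavierStokesRegularity.FluidComputer.GateBudget

open Real Set Filter Topology
open Literature.Analysis.FluidPDE.Tao2016AveragedNS
open Literature.Analysis.FluidPDE.Tao2016AveragedNS.Thm53 (antitoneOn_intFactor monotoneOn_intFactor
  antitoneOn_sub_of_deriv_le monotoneOn_sub_of_le_deriv init_a init_b init_c init_d init_e)

variable {ε σ μ R K : ℝ} {X : ℝ → Fin 5 → ℝ}

/-! ## §6 The clock budget and the Zeno law -/

/-- AM–GM for the rotor flux: `2cad ≤ Λc² + d²/Λ` when `|a| ≤ 1`, `Λ > 0`. [folklore] -/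
theorem flux_le_amgm {a c d Λ : ℝ} (ha : |a| ≤ 1) (hΛ : 0 < Λ) :
    2 * (c * a * d) ≤ Λ * c ^ 2 + d ^ 2 / Λ := by
  have h1 : c * a * d ≤ |c| * |d| := by
    have : |c * a * d| = |c| * |a| * |d| := by rw [abs_mul, abs_mul]
    have h2 : |c| * |a| * |d| ≤ |c| * 1 * |d| :=
      mul_le_mul_of_nonneg_right (mul_le_mul_of_nonneg_left ha (abs_nonneg _)) (abs_nonneg _)
    calc c * a * d ≤ |c * a * d| := le_abs_self _
      _ ≤ |c| * |d| := by rw [this]; simpa using h2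
  have h3 : Λ * (2 * (|c| * |d|)) ≤ Λ * (Λ * c ^ 2 + d ^ 2 / Λ) := by
    have : Λ * (Λ * c ^ 2 + d ^ 2 / Λ) = Λ ^ 2 * c ^ 2 + d ^ 2 := by field_simp
    rw [this]
    nlinarith [sq_nonneg (Λ * |c| - |d|), sq_abs c, sq_abs d]
  have h4 : 2 * (|c| * |d|) ≤ Λ * c ^ 2 + d ^ 2 / Λ := le_of_mul_le_mul_left h3 hΛ
  linarith

/-- **CLOCK BUDGET + ZENO LAW, derivative form.** For `Λ > 0` (`ε ≥ 0`, `μ > 0`, `R ≥ 0`, `K > 0`) the function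
`Ψ(t) = (d²+ã²) + (RΛ/μ)·b - (R/(ΛK))·ã - (RΛε/μ)·t` is non-increasing on `[0,∞)` along every trajectory from
(5.6): `∂ₜΨ = 2Rcad - RΛc² - (R/Λ)d² + (RΛε/μ)(a² - 1) ≤ 0`, using `∂ₜb = εa² - μc²` (the amplifier drains the
clock by exactly `μc²`), `∂ₜã = Kd²`, `|a| ≤ 1` and `2cad ≤ Λc² + d²/Λ`.
[cite: Tao2016AveragedNS, §5.5 (b-eq), (ta-eq), (dora)] -/
theorem zeno_antitone (hX : ∀ t, HasDerivAt X (fiveGateCircuit ε σ μ R K (X t)) t) (h0 : X 0 = delayInit)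
    (hε : 0 ≤ ε) (hμ : 0 < μ) (hR : 0 ≤ R) (hK : 0 < K) {Λ : ℝ} (hΛ : 0 < Λ) :
    AntitoneOn (fun t => (X t 3 ^ 2 + X t 4 ^ 2) + R * Λ / μ * X t 1 - R / (Λ * K) * X t 4
      - R * Λ * ε / μ * t) (Ici 0) := by
  have hf : ∀ t ∈ Ici (0:ℝ), HasDerivAt (fun s => (X s 3 ^ 2 + X s 4 ^ 2) + R * Λ / μ * X s 1 - R / (Λ * K) * X s 4)
      (2 * R * X t 2 * X t 0 * X t 3 + R * Λ / μ * (ε * X t 0 ^ 2 - μ * X t 2 ^ 2)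
        - R / (Λ * K) * (K * X t 3 ^ 2)) t := fun t _ =>
    ((out_energy (hX t)).add ((hasDerivAt_b hX t).const_mul (R * Λ / μ))).sub
      ((hasDerivAt_e hX t).const_mul (R / (Λ * K)))
  have hanti := antitoneOn_sub_of_deriv_le (φ := fun _ => R * Λ * ε / μ) (Φ := fun s => R * Λ * ε / μ * s)
    (convex_Ici 0) hf (fun s _ => ((hasDerivAt_id' s).const_mul (R * Λ * ε / μ)).congr_deriv (by simp))
    (fun s _ => by
      have ha : |X s 0| ≤ 1 := traj_abs_le_one hX h0 s 0
      have ha2 : X s 0 ^ 2 ≤ 1 := traj_sq_le_one hX h0 s 0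
      have hflux := flux_le_amgm (c := X s 2) (a := X s 0) (d := X s 3) ha hΛ
      have e1 : R * Λ / μ * (ε * X s 0 ^ 2 - μ * X s 2 ^ 2)
          = R * Λ * ε / μ * X s 0 ^ 2 - R * Λ * X s 2 ^ 2 := by field_simp
      have e2 : R / (Λ * K) * (K * X s 3 ^ 2) = R * (X s 3 ^ 2 / Λ) := by field_simp
      rw [e1, e2]
      have h1 : R * (2 * (X s 2 * X s 0 * X s 3)) ≤ R * (Λ * X s 2 ^ 2 + X s 3 ^ 2 / Λ) :=
        mul_le_mul_of_nonneg_left hflux hR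
      have h2 : R * Λ * ε / μ * X s 0 ^ 2 ≤ R * Λ * ε / μ := mul_le_of_le_one_right (by positivity) ha2
      nlinarith)
  simpa only [sub_sub] using hanti

/-- **ZENO LAW.** For every `Λ > 0` and `T ≥ 0`:
`d(T)² + ã(T)² ≤ (RΛ/μ)·(εT - b(T)) + (R/(ΛK))·ã(T)`; here `μ·(εT - b(T)) ≥ μ∫₀ᵀc²` is the clock budget.
[cite: Tao2016AveragedNS, §5.5 (b-eq), (ta-eq), (dora)] -/
theorem zeno_law (hX : ∀ t, HasDerivAt X (fiveGateCircuit ε σ μ R K (X t)) t) (h0 : X 0 = delayInit)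
    (hε : 0 ≤ ε) (hμ : 0 < μ) (hR : 0 ≤ R) (hK : 0 < K) {Λ : ℝ} (hΛ : 0 < Λ) {T : ℝ} (hT : 0 ≤ T) :
    X T 3 ^ 2 + X T 4 ^ 2 ≤ R * Λ / μ * (ε * T - X T 1) + R / (Λ * K) * X T 4 := by
  have h := zeno_antitone hX h0 hε hμ hR hK hΛ (mem_Ici.2 le_rfl) (mem_Ici.2 hT) hT
  simp only [init_b h0, init_d h0, init_e h0] at h
  have : (0:ℝ) ^ 2 = 0 := by norm_num
  simp only [this, mul_zero, add_zero, sub_zero] at h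
  have e : R * Λ / μ * (ε * T - X T 1) = R * Λ * ε / μ * T - R * Λ / μ * X T 1 := by ring
  rw [e]
  linarith

/-- **ZENO LAW with the trigger budget inserted** (`-b(T) ≤ (ε+σ)T`): for every `Λ > 0`, `T ≥ 0`,
`ã(T)² ≤ (RΛ/μ)(2ε+σ)T + (R/(ΛK))ã(T)`. [cite: Tao2016AveragedNS, §5.5 (b-eq), (ta-eq), (dora), (ob-2)] -/
theorem zeno_law' (hX : ∀ t, HasDerivAt X (fiveGateCircuit ε σ μ R K (X t)) t) (h0 : X 0 = delayInit)
    (hε : 0 ≤ ε) (hσ : 0 ≤ σ) (hμ : 0 < μ) (hR : 0 ≤ R) (hK : 0 < K) {Λ : ℝ} (hΛ : 0 < Λ) {T : ℝ}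
    (hT : 0 ≤ T) : X T 4 ^ 2 ≤ R * Λ / μ * ((2 * ε + σ) * T) + R / (Λ * K) * X T 4 := by
  have h := zeno_law hX h0 hε hμ hR hK hΛ hT
  have hb : -X T 1 ≤ (ε + σ) * T := by
    have := abs_b_le hX h0 hε hσ hT
    have := neg_abs_le (X T 1)
    linarith
  have hcoef : 0 ≤ R * Λ / μ := by positivity
  have h2 : R * Λ / μ * (ε * T - X T 1) ≤ R * Λ / μ * ((2 * ε + σ) * T) :=
    mul_le_mul_of_nonneg_left (by linarith) hcoef
  nlinarith [sq_nonneg (X T 3)]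

/-! ## §7 The design inequality and the necessity windows (general couplings) -/

/-- **THE DESIGN INEQUALITY (Zeno law, optimised).** If the gate has delivered `ã(T) ≥ θ > 0` by time `T ≥ 0`
then `K·θ³·μ ≤ 4R²·(2ε+σ)·T` (`ε, σ ≥ 0`, `μ, K > 0`, `R ≥ 0`). Necessary for firing, for EVERY value of the
other couplings: rotor `R² ≥ μKθ³/(4(2ε+σ)T)`, drain `K ≤ 4R²(2ε+σ)T/(μθ³)`, amplifier
`μ ≤ 4R²(2ε+σ)T/(Kθ³)`, clock+seed `2ε+σ ≥ μKθ³/(4R²T)`. (Proof: `Λ = 2R/(Kã(T))` in `zeno_law'`.)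
[cite: Tao2016AveragedNS, §5.5 Theorem 5.3] -/
theorem design_inequality (hX : ∀ t, HasDerivAt X (fiveGateCircuit ε σ μ R K (X t)) t)
    (h0 : X 0 = delayInit) (hε : 0 ≤ ε) (hσ : 0 ≤ σ) (hμ : 0 < μ) (hR : 0 ≤ R) (hK : 0 < K) {T θ : ℝ}
    (hT : 0 ≤ T) (hθ : 0 < θ) (hθe : θ ≤ X T 4) :
    K * θ ^ 3 * μ ≤ 4 * R ^ 2 * ((2 * ε + σ) * T) := by
  set u := X T 4 with hu
  have hu0 : 0 < u := lt_of_lt_of_le hθ hθe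
  rcases eq_or_lt_of_le hR with hR0 | hRpos
  · exfalso
    have h := zeno_law' hX h0 hε hσ hμ hR hK one_pos hT
    rw [← hR0] at h
    simp only [zero_mul, zero_div, zero_add] at h
    nlinarith
  · have hΛ : 0 < 2 * R / (K * u) := by positivity
    have h := zeno_law' hX h0 hε hσ hμ hR hK hΛ hT
    have e1 : R / (2 * R / (K * u) * K) * u = u ^ 2 / 2 := by
      field_simp
    have e2 : R * (2 * R / (K * u)) / μ * ((2 * ε + σ) * T) = 2 * R ^ 2 * ((2 * ε + σ) * T) / (μ * K * u) := by
      field_simp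
    rw [e1, e2] at h
    have h3 : u ^ 2 / 2 ≤ 2 * R ^ 2 * ((2 * ε + σ) * T) / (μ * K * u) := by linarith
    rw [div_le_div_iff₀ (by norm_num) (by positivity)] at h3
    have h5 : θ ^ 3 ≤ u ^ 3 := pow_le_pow_left₀ hθ.le hθe 3
    nlinarith [mul_le_mul_of_nonneg_right h5 (by positivity : (0:ℝ) ≤ μ * K)]

/-- **THE AMPLIFIER WINDOW (general couplings).** An output `ã(T) ≥ θ > 0` at `T ≥ 0` needs the amplifier
BOTH strong enough to arm the trigger in time — `θ ≤ (Rσ/κ)(e^{κT²/2} - 1)`, `κ = μ(ε+σ)` (part 2) — AND weak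
enough that the pulse is not too brief for the drain: `μ·Kθ³ ≤ 4R²(2ε+σ)T`.
[cite: Tao2016AveragedNS, §5.5 Theorem 5.3, caricature (i)–(iii)] -/
theorem amplifier_window (hX : ∀ t, HasDerivAt X (fiveGateCircuit ε σ μ R K (X t)) t)
    (h0 : X 0 = delayInit) (hε : 0 ≤ ε) (hσ : 0 ≤ σ) (hμ : 0 < μ) (hR : 0 ≤ R) (hK : 0 < K)
    (hκ : 0 < μ * (ε + σ)) {T θ : ℝ} (hT : 0 ≤ T) (hθ : 0 < θ) (hθe : θ ≤ X T 4) :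
    θ ≤ R * σ / (μ * (ε + σ)) * (exp (μ * (ε + σ) * T ^ 2 / 2) - 1)
      ∧ μ * (K * θ ^ 3) ≤ 4 * R ^ 2 * ((2 * ε + σ) * T) := by
  refine ⟨?_, ?_⟩
  · have h := output_le_arming hX h0 hε hσ hμ.le hR hκ hT
    have he : X T 4 ≤ sqrt (X T 3 ^ 2 + X T 4 ^ 2) :=
      (le_abs_self _).trans (abs_le_sqrt (by nlinarith [sq_nonneg (X T 3)]))
    linarith
  · have := design_inequality hX h0 hε hσ hμ hR hK hT hθ hθe
    linarith

/-! ## §8 Tao's family: the amplitude, the rotor knob, the drain window -/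

/-- **TAO'S FAMILY: `ε²·M·K·θ³ ≤ 12T`.** Along every exact trajectory of `delayCircuitWith K M ε` (`K, M > 0`,
`0 < ε ≤ 1`) from (5.6): an output `ã(T) ≥ θ > 0` at time `T ≥ 0` forces `ε²MKθ³ ≤ 12T` (the design
inequality with `σ = ε²e^{-M} ≤ ε`, `μ = ε⁻¹M`, `R = ε⁻²`). [cite: Tao2016AveragedNS, §5.5 Theorem 5.3] -/
theorem taoFamily_design_inequality {K M ε : ℝ} {X : ℝ → Fin 5 → ℝ}
    (hX : ∀ t, HasDerivAt X (delayCircuitWith K M ε (X t)) t) (h0 : X 0 = delayInit)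
    (hK : 0 < K) (hM : 0 < M) (hε : 0 < ε) (hε1 : ε ≤ 1) {T θ : ℝ} (hT : 0 ≤ T) (hθ : 0 < θ)
    (hθe : θ ≤ X T 4) : ε ^ 2 * M * K * θ ^ 3 ≤ 12 * T := by
  rw [delayCircuitWith_eq_fiveGate] at hX
  have hσ : 0 ≤ ε ^ 2 * exp (-M) := by positivity
  have h := design_inequality hX h0 hε.le hσ (by positivity) (by positivity) hK hT hθ hθe
  have hσε : ε ^ 2 * exp (-M) ≤ ε := by
    have hexp : exp (-M) ≤ 1 := by rw [exp_le_one_iff]; linarith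
    nlinarith [mul_le_mul_of_nonneg_left hexp (sq_nonneg ε), mul_le_mul_of_nonneg_left hε1 hε.le]
  have h' : K * θ ^ 3 * (ε⁻¹ * M) ≤ 4 * ((ε ^ 2)⁻¹) ^ 2 * (3 * ε * T) :=
    h.trans (mul_le_mul_of_nonneg_left (mul_le_mul_of_nonneg_right (by linarith) hT) (by positivity))
  have e1 : ε ^ 2 * M * K * θ ^ 3 = (K * θ ^ 3 * (ε⁻¹ * M)) * ε ^ 3 := by field_simp
  have e2 : 12 * T = (4 * ((ε ^ 2)⁻¹) ^ 2 * (3 * ε * T)) * ε ^ 3 := by field_simp; ring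
  rw [e1, e2]
  exact mul_le_mul_of_nonneg_right h' (pow_pos hε 3).le

/-- **TAO'S GATE FIRES ONLY IF THE AMPLITUDE IS POLYNOMIALLY SMALL IN `M·K`.** If `ã(2) ≥ 1/2` (a quarter of
the energy delivered by the end of Theorem 5.3's window `[0,2]`) then `ε²MK ≤ 192` and `ε ≤ 14/√(MK)`.
[cite: Tao2016AveragedNS, §5.5 Theorem 5.3 (jb)] -/
theorem taoFamily_fires_only_if {K M ε : ℝ} {X : ℝ → Fin 5 → ℝ}
    (hX : ∀ t, HasDerivAt X (delayCircuitWith K M ε (X t)) t) (h0 : X 0 = delayInit)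
    (hK : 0 < K) (hM : 0 < M) (hε : 0 < ε) (hε1 : ε ≤ 1) (hfire : 1 / 2 ≤ X 2 4) :
    ε ^ 2 * M * K ≤ 192 ∧ ε ≤ 14 / sqrt (M * K) := by
  have h := taoFamily_design_inequality hX h0 hK hM hε hε1 (by norm_num : (0:ℝ) ≤ 2) (by norm_num) hfire
  have h1 : ε ^ 2 * M * K ≤ 192 := by nlinarith
  refine ⟨h1, ?_⟩
  have hs : 0 < sqrt (M * K) := sqrt_pos.2 (by positivity)
  rw [le_div_iff₀ hs]
  have hx : (ε * sqrt (M * K)) ^ 2 ≤ 192 := by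
    rw [mul_pow, sq_sqrt (by positivity)]; linarith
  nlinarith [mul_pos hε hs]

/-- **TAO'S OWN CIRCUIT (5.5)** (`M = K¹⁰`): `ã(2) ≥ 1/2` forces `ε²K¹¹ ≤ 192`, i.e. `ε ≤ 14·K^{-11/2}` — the
necessity counterpart of `AmplitudeKnob.taoMember_polyPulse` (`ε ≤ e^{-700K⁹log K}/K¹⁸⁰⁰` suffices) and of the
tree's `DelayedAbruptTransition_holds` (`ε ≤ e^{-10K¹⁰}/K¹⁰⁰`). [cite: Tao2016AveragedNS, §5.5 Theorem 5.3] -/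
theorem taoMember_fires_only_if {K ε : ℝ} {X : ℝ → Fin 5 → ℝ}
    (hX : ∀ t, HasDerivAt X (delayCircuit K ε (X t)) t) (h0 : X 0 = delayInit)
    (hK : 0 < K) (hε : 0 < ε) (hε1 : ε ≤ 1) (hfire : 1 / 2 ≤ X 2 4) : ε ^ 2 * K ^ 11 ≤ 192 := by
  simp only [← delayCircuitWith_pow_ten] at hX
  have h := (taoFamily_fires_only_if hX h0 hK (by positivity) hε hε1 hfire).1
  calc ε ^ 2 * K ^ 11 = ε ^ 2 * K ^ 10 * K := by ring
    _ ≤ 192 := h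

/-- **THE ROTOR KNOB (necessity).** Keep Tao's clock `ε`, seed `ε²e^{-M}`, amplifier `ε⁻¹M` and drain `K` but
let the rotor coupling `R ≥ 0` be free (`fiveGateCircuit ε (ε²e^{-M}) (ε⁻¹M) R K`; Tao: `R = ε⁻²`). An output
`ã(T) ≥ θ > 0` at `T ≥ 0` forces `M·K·θ³ ≤ 12T·(Rε)²`: the rotor must beat the clock scale `1/ε` by the factor
`√(MKθ³/(12T))` (for (5.5), `θ = 1/2`, `T = 2`: `Rε ≥ K^{11/2}/14`). [cite: Tao2016AveragedNS, §5.4, §5.5] -/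
theorem rotorKnob_necessary {K M ε R : ℝ} {X : ℝ → Fin 5 → ℝ}
    (hX : ∀ t, HasDerivAt X (fiveGateCircuit ε (ε ^ 2 * exp (-M)) (ε⁻¹ * M) R K (X t)) t)
    (h0 : X 0 = delayInit) (hK : 0 < K) (hM : 0 < M) (hε : 0 < ε) (hε1 : ε ≤ 1) (hR : 0 ≤ R)
    {T θ : ℝ} (hT : 0 ≤ T) (hθ : 0 < θ) (hθe : θ ≤ X T 4) :
    M * K * θ ^ 3 ≤ 12 * T * (R * ε) ^ 2 := by
  have hσ : 0 ≤ ε ^ 2 * exp (-M) := by positivity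
  have h := design_inequality hX h0 hε.le hσ (by positivity) hR hK hT hθ hθe
  have hσε : ε ^ 2 * exp (-M) ≤ ε := by
    have hexp : exp (-M) ≤ 1 := by rw [exp_le_one_iff]; linarith
    nlinarith [mul_le_mul_of_nonneg_left hexp (sq_nonneg ε), mul_le_mul_of_nonneg_left hε1 hε.le]
  have h' : K * θ ^ 3 * (ε⁻¹ * M) ≤ 4 * R ^ 2 * (3 * ε * T) :=
    h.trans (mul_le_mul_of_nonneg_left (mul_le_mul_of_nonneg_right (by linarith) hT) (by positivity))
  have e1 : M * K * θ ^ 3 = (K * θ ^ 3 * (ε⁻¹ * M)) * ε := by field_simp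
  have e2 : 12 * T * (R * ε) ^ 2 = (4 * R ^ 2 * (3 * ε * T)) * ε := by ring
  rw [e1, e2]
  exact mul_le_mul_of_nonneg_right h' hε.le

/-- **THE DRAIN WINDOW of Tao's family.** An output `θ ≤ ã(T)` with `θ > 0`, `T > 0`, needs the drain in the
window `log(1/(1-θ))/(2T) ≤ K ≤ 12T/(ε²Mθ³)` (the lower edge is informative for `θ < 1`; `ã ≤ 1` always):
too slow and it cannot load `ã` in time (the tree's `DelayWith.output_deficit_ge`: `1 - ã(T) ≥ e^{-2KT}`), too
fast and it throttles the rotor (Zeno law).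
[cite: Tao2016AveragedNS, §5.5 Theorem 5.3, caricature (iii)–(iv)] -/
theorem taoFamily_drain_window {K M ε : ℝ} {X : ℝ → Fin 5 → ℝ}
    (hX : ∀ t, HasDerivAt X (delayCircuitWith K M ε (X t)) t) (h0 : X 0 = delayInit)
    (hK : 0 < K) (hM : 0 < M) (hε : 0 < ε) (hε1 : ε ≤ 1) {T θ : ℝ} (hT : 0 < T) (hθ : 0 < θ)
    (hθe : θ ≤ X T 4) :
    Real.log (1 / (1 - θ)) / (2 * T) ≤ K ∧ K ≤ 12 * T / (ε ^ 2 * M * θ ^ 3) := by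
  refine ⟨?_, ?_⟩
  · have hE : ∀ t, energy (X t) ≤ 1 := fun t => (delayCircuitWith_energy_init hX h0 t).le
    have h := DelayWith.output_deficit_ge hK.le hX hE hT.le (t₀ := 0)
    rw [init_e h0, sub_zero, one_mul, sub_zero] at h
    -- h : exp (-(2K) T) ≤ 1 - ã(T) ≤ 1 - θ
    have h2 : exp (-(2 * K) * T) ≤ 1 - θ := by linarith
    have h3 : -(2 * K) * T ≤ Real.log (1 - θ) := by
      have := Real.log_le_log (exp_pos _) h2
      rwa [Real.log_exp] at this
    rw [one_div, Real.log_inv, div_le_iff₀ (by linarith)]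
    linarith
  · have h := taoFamily_design_inequality hX h0 hK hM hε hε1 hT.le hθ hθe
    rw [le_div_iff₀ (by positivity)]
    linarith

end Summit.NavierStokesRegularity.FluidComputer.GateBudget
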